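import Mathlib
import Summits.NavierStokesRegularity.NavierStokesRegularity.Theorems.EulerZoomLiouvillePowerGaugeEulerLiouvilleSelfSimilarKelvinFlow
import Literature.Analysis.ODE.EvolutionMapSmooth
import Literature.Analysis.ODE.EvolutionMapAutonomous
import HarnessLib.Audit

/-!
# Rung C1 of the crux `EulerZoomLiouville.PowerGaugeEulerLiouville`: the SELF-SIMILAR LAGRANGIAN FLOW OF A `C²` PROFILE
# (W1 stage S1 — the `C²` similarity-flow API: flow, group law, variational equation, outgoing bounds)

Route №10 `EulerZoomLiouville` (NavierStokesRegularity), crux E = stmt-NavierStokesRegularity-19832, tenure rung C1,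
registered residue `stub_selfSimilarExtremalRest`, sub-stratum W1 («`C²` but not `C^∞` bounded profiles»).  Lineage
ns-typeII-p2 (gen 8, INTERIM LEAD).  The lead's `…SelfSimilarKelvinFlow` (ns `…Kelvin`) builds the flow `Φ_s` of the
similarity field `W = γy + V` from the `C^∞` space–time calculus (`IsSmoothSpaceTimeOn`); every later file of the
classical chain therefore carries `hV : ContDiff ℝ ∞ V`, although CIV (3.3) only gives `V ∈ C²`.  This file re-does the
root at `C²` (namespace `…PowerGaugeEulerLiouville.C2.Kelvin`, same short names, so that the chain can be twinned by
substitution):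

* `lipschitzWith_selfSimilarTransport`, `isUniformlyLipschitzOn_transport` — `V ∈ C¹`, `‖DV‖ ≤ K` ⇒ `W` globally
  Lipschitz (Cauchy–Lipschitz hypotheses on the time set `univ`);
* `hasDerivAt_flow`, `continuous_flow_apply`, `flow_add`, `flow_eq_self_of_mem_nodalSet` (`flow_zero` = `Kelvin.flow_zero`),
  `hasDerivAt_flow_neg` — the flow, its group law and rest points (`C¹`);
* `contDiff_flow_uncurry`, `contDiff_flow` — **for `V ∈ C²` the flow is jointly `C²` in `(s, y)`** (Hartman V.4.1 /
  Teschl 2.10 in the tree: `ODE.IsUniformlyLipschitzOn.contDiffOn_evolutionMap_uncurry`, `n = 2`);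
* **`hasDerivAt_fderiv_flow` — the VARIATIONAL EQUATION `d/ds DΦ_s(y) = (γI + DV(Φ_s y)) ∘ DΦ_s(y)` for `V ∈ C²`**,
  proved directly from the joint `C²` regularity by the symmetry of the second derivative of `(s, y) ↦ Φ_s y`
  (Schwarz) and `∂_s Φ = W ∘ Φ` — no `C^∞` space–time calculus;
* `norm_exp_neg_smul_flow_sub_le`, `norm_flow_ge`, `norm_flow_le` — outgoing bounds (`C¹`, `‖V‖ ≤ M`).

WHAT THIS IS NOT: not NS, not E, not rung C1 — Lagrangian bookkeeping for `C²` profiles with bounded gradient; the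
`C²` twins of the chain (S2–S5) follow in sequel files. [folklore; ConstantinIgnatovaVicol2026Putative §3.4.1 (3.21)–(3.22);
Hartman, *ODE*, Ch. V Cor. 4.1; MajdaBertozziCUP2002 §4.2 (4.45)]
-/

noncomputable section

-- flat `Theorems/<Route><Decl>…` files of one crux share the namespace of the crux (tree convention)
set_option linter.dupNamespace false

open MeasureTheory Set Filter Topology Metric Function InnerProductSpace
open scoped RealInnerProductSpace NNReal ContDiff

namespace Summit.NavierStokesRegularity.NavierStokesRegularity.Theorems.PowerGaugeEulerLiouville.C2.Kelvin

open Literature.Analysis Literature.Analysis.FluidPDE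

variable {γ : ℝ} {V : EuclideanSpace ℝ (Fin 3) → EuclideanSpace ℝ (Fin 3)}

/-! ### The similarity field of a `C¹` profile with bounded gradient is globally Lipschitz -/

/-- `W = γy + V` is globally Lipschitz with constant `|γ| + K` when `V ∈ C¹`, `‖DV‖ ≤ K`. [folklore] -/
theorem lipschitzWith_selfSimilarTransport (hV : ContDiff ℝ 1 V) {K : ℝ} (hK : ∀ y, ‖fderiv ℝ V y‖ ≤ K) :
    LipschitzWith (Real.toNNReal (|γ| + K)) (selfSimilarTransport γ 0 V) := by
  have hVd : Differentiable ℝ V := hV.differentiable one_ne_zero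
  refine lipschitzWith_of_nnnorm_fderiv_le
    ((PowerGaugeEulerLiouville.Kelvin.contDiff_selfSimilarTransport (γ := γ) hV).differentiable one_ne_zero)
    fun y => ?_
  have h := PowerGaugeEulerLiouville.Kelvin.norm_fderiv_selfSimilarTransport_le (γ := γ) hVd hK y
  rw [← norm_toNNReal]
  exact Real.toNNReal_le_toNNReal h

/-- `W` satisfies the Cauchy–Lipschitz hypotheses on the time set `univ` (`V ∈ C¹`, `‖DV‖ ≤ K`). [folklore] -/
theorem isUniformlyLipschitzOn_transport (hV : ContDiff ℝ 1 V) {K : ℝ} (hK : ∀ y, ‖fderiv ℝ V y‖ ≤ K) :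
    ODE.IsUniformlyLipschitzOn (fun _ : ℝ => selfSimilarTransport γ 0 V) univ :=
  ODE.IsUniformlyLipschitzOn.of_lipschitzWith (fun _ => continuousOn_const)
    fun _ _ => lipschitzWith_selfSimilarTransport hV hK

/-! ### The flow: trajectories, group law, rest points -/

/-- **(3.21)**: `d/ds Φ_s(y) = W(Φ_s(y))` (`V ∈ C¹`, `‖DV‖ ≤ K`). [cite: ConstantinIgnatovaVicol2026Putative, §3.4.1 eq. (3.21)] -/
theorem hasDerivAt_flow (hV : ContDiff ℝ 1 V) {K : ℝ} (hK : ∀ y, ‖fderiv ℝ V y‖ ≤ K)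
    (s : ℝ) (y : EuclideanSpace ℝ (Fin 3)) :
    HasDerivAt (fun r => ODE.evolutionMap (fun _ : ℝ => selfSimilarTransport γ 0 V) 0 r y)
      (selfSimilarTransport γ 0 V (ODE.evolutionMap (fun _ : ℝ => selfSimilarTransport γ 0 V) 0 s y)) s :=
  (isUniformlyLipschitzOn_transport hV hK).hasDerivAt_evolutionMap convex_univ (mem_univ _) univ_mem y

/-- Trajectories `s ↦ Φ_s y` are continuous. [folklore] -/
theorem continuous_flow_apply (hV : ContDiff ℝ 1 V) {K : ℝ} (hK : ∀ y, ‖fderiv ℝ V y‖ ≤ K)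
    (y : EuclideanSpace ℝ (Fin 3)) :
    Continuous fun s => ODE.evolutionMap (fun _ : ℝ => selfSimilarTransport γ 0 V) 0 s y :=
  continuous_iff_continuousAt.2 fun s => (hasDerivAt_flow (γ := γ) hV hK s y).continuousAt

/-- **Group law** `Φ_{s+t} = Φ_s ∘ Φ_t` (autonomous field; `V ∈ C¹`, `‖DV‖ ≤ K`). [folklore] -/
theorem flow_add (hV : ContDiff ℝ 1 V) {K : ℝ} (hK : ∀ y, ‖fderiv ℝ V y‖ ≤ K)
    (s t : ℝ) (y : EuclideanSpace ℝ (Fin 3)) :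
    ODE.evolutionMap (fun _ : ℝ => selfSimilarTransport γ 0 V) 0 (s + t) y =
      ODE.evolutionMap (fun _ : ℝ => selfSimilarTransport γ 0 V) 0 s
        (ODE.evolutionMap (fun _ : ℝ => selfSimilarTransport γ 0 V) 0 t y) := by
  have hL := isUniformlyLipschitzOn_transport (γ := γ) hV hK
  have h1 := ODE.evolutionMap_const_eq_evolutionMap_zero (lipschitzWith_selfSimilarTransport (γ := γ) hV hK)
    t (t + s) (ODE.evolutionMap (fun _ : ℝ => selfSimilarTransport γ 0 V) 0 t y)
  rw [add_sub_cancel_left] at h1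
  rw [← h1, hL.evolutionMap_trans convex_univ (mem_univ _) (mem_univ _) (mem_univ _), add_comm]

/-- **Stagnation points are rest points**: `Φ_s z = z` for `z ∈ 𝒩_W`. [folklore] -/
theorem flow_eq_self_of_mem_nodalSet (hV : ContDiff ℝ 1 V) {K : ℝ} (hK : ∀ y, ‖fderiv ℝ V y‖ ≤ K)
    {z : EuclideanSpace ℝ (Fin 3)} (hz : z ∈ selfSimilarNodalSet γ 0 V) (s : ℝ) :
    ODE.evolutionMap (fun _ : ℝ => selfSimilarTransport γ 0 V) 0 s z = z :=
  (isUniformlyLipschitzOn_transport (γ := γ) hV hK).evolutionMap_eq_self_of_forall_eq_zero convex_univ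
    (fun _ _ => hz) (mem_univ _) (mem_univ _)

/-- The backward trajectory `t ↦ Φ_{−t} y` solves `Y' = −W(Y)`. [folklore] -/
theorem hasDerivAt_flow_neg (hV : ContDiff ℝ 1 V) {K : ℝ} (hK : ∀ y, ‖fderiv ℝ V y‖ ≤ K)
    (y : EuclideanSpace ℝ (Fin 3)) (t : ℝ) :
    HasDerivAt (fun r => ODE.evolutionMap (fun _ : ℝ => selfSimilarTransport γ 0 V) 0 (-r) y)
      ((-1 : ℝ) • selfSimilarTransport γ 0 V
        (ODE.evolutionMap (fun _ : ℝ => selfSimilarTransport γ 0 V) 0 (-t) y)) t := by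
  have h1 := hasDerivAt_flow (γ := γ) hV hK (-t) y
  have h2 : HasDerivAt (fun r : ℝ => -r) (-1 : ℝ) t := hasDerivAt_neg t
  exact h1.scomp t h2

/-! ### `C²` profiles: the flow is jointly `C²`, and the variational equation -/

/-- **The flow of a `C²` profile is jointly `C²` in `(s, y)`** (Hartman V Cor. 4.1 / Teschl Thm 2.10, tree form
`ODE.IsUniformlyLipschitzOn.contDiffOn_evolutionMap_uncurry` with `n = 2`). [cite: ConstantinIgnatovaVicol2026Putative, §3.4.1 eq. (3.21)] -/
theorem contDiff_flow_uncurry (hV : ContDiff ℝ 2 V) {K : ℝ} (hK : ∀ y, ‖fderiv ℝ V y‖ ≤ K) :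
    ContDiff ℝ 2 fun p : ℝ × EuclideanSpace ℝ (Fin 3) =>
      ODE.evolutionMap (fun _ : ℝ => selfSimilarTransport γ 0 V) 0 p.1 p.2 := by
  have hL := isUniformlyLipschitzOn_transport (γ := γ) (hV.of_le (by norm_num)) hK
  have hW : ContDiffOn ℝ 2 (uncurry fun _ : ℝ => selfSimilarTransport γ 0 V) (univ ×ˢ univ) := by
    have h : ContDiff ℝ 2 (uncurry fun _ : ℝ => selfSimilarTransport γ 0 V) :=
      (PowerGaugeEulerLiouville.Kelvin.contDiff_selfSimilarTransport (γ := γ) hV).comp contDiff_snd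
    exact h.contDiffOn
  have h := hL.contDiffOn_evolutionMap_uncurry convex_univ uniqueDiffOn_univ (by norm_num) hW (mem_univ (0 : ℝ))
  rw [univ_prod_univ] at h
  exact contDiffOn_univ.1 h

/-- Each `Φ_s` is `C²` (for `V ∈ C²`). [cite: ConstantinIgnatovaVicol2026Putative, §3.4.1 eq. (3.21)] -/
theorem contDiff_flow (hV : ContDiff ℝ 2 V) {K : ℝ} (hK : ∀ y, ‖fderiv ℝ V y‖ ≤ K) (s : ℝ) :
    ContDiff ℝ 2 (ODE.evolutionMap (fun _ : ℝ => selfSimilarTransport γ 0 V) 0 s) :=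
  (contDiff_flow_uncurry (γ := γ) hV hK).comp (contDiff_const.prodMk contDiff_id)

/-- **(3.22), the variational equation for a `C²` profile**: `d/ds DΦ_s(y) = (γ I + DV(Φ_s y)) ∘ DΦ_s(y)`.  From the
joint `C²` regularity of `F(s, y) = Φ_s y`: `s ↦ D_yF(s, y)` has derivative `D²F(s,y)(1,0)|_{0 × E}`; by the symmetry of
`D²F` this is `D_y[∂_sF](s,y) = D_y[W ∘ F](s, y) = DW(Φ_s y) ∘ DΦ_s(y)`.
[cite: ConstantinIgnatovaVicol2026Putative, §3.4.1 eq. (3.22); MajdaBertozziCUP2002, §4.2 eq. (4.45)] -/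
theorem hasDerivAt_fderiv_flow (hV : ContDiff ℝ 2 V) {K : ℝ} (hK : ∀ y, ‖fderiv ℝ V y‖ ≤ K)
    (s : ℝ) (y : EuclideanSpace ℝ (Fin 3)) :
    HasDerivAt (fun r => fderiv ℝ (ODE.evolutionMap (fun _ : ℝ => selfSimilarTransport γ 0 V) 0 r) y)
      ((γ • ContinuousLinearMap.id ℝ (EuclideanSpace ℝ (Fin 3)) +
          fderiv ℝ V (ODE.evolutionMap (fun _ : ℝ => selfSimilarTransport γ 0 V) 0 s y)).comp
        (fderiv ℝ (ODE.evolutionMap (fun _ : ℝ => selfSimilarTransport γ 0 V) 0 s) y)) s := by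
  set W := selfSimilarTransport γ 0 V with hWdef
  set Φ := ODE.evolutionMap (fun _ : ℝ => W) 0 with hΦ
  set F : ℝ × EuclideanSpace ℝ (Fin 3) → EuclideanSpace ℝ (Fin 3) := fun p => Φ p.1 p.2 with hF
  have hV1 : ContDiff ℝ 1 V := hV.of_le (by norm_num)
  have hVd : Differentiable ℝ V := hV1.differentiable one_ne_zero
  have hF2 : ContDiff ℝ 2 F := contDiff_flow_uncurry (γ := γ) hV hK
  have hFd : Differentiable ℝ F := hF2.differentiable (by norm_num)
  have hDF : ContDiff ℝ 1 (fderiv ℝ F) := hF2.fderiv_right (m := 1) (by norm_cast)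
  have hDFd : Differentiable ℝ (fderiv ℝ F) := hDF.differentiable one_ne_zero
  have hWd : Differentiable ℝ W :=
    (PowerGaugeEulerLiouville.Kelvin.contDiff_selfSimilarTransport (γ := γ) hV1).differentiable one_ne_zero
  -- the inclusions `r ↦ (r, y)` and `x ↦ (s, x)`
  set ι₁ : ℝ →L[ℝ] ℝ × EuclideanSpace ℝ (Fin 3) := ContinuousLinearMap.inl ℝ ℝ (EuclideanSpace ℝ (Fin 3)) with hι₁
  set ι₂ : EuclideanSpace ℝ (Fin 3) →L[ℝ] ℝ × EuclideanSpace ℝ (Fin 3) :=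
    ContinuousLinearMap.inr ℝ ℝ (EuclideanSpace ℝ (Fin 3)) with hι₂
  -- (1) slices of `DF`: `DΦ_r(x) = DF(r,x) ∘ ι₂`
  have hslice : ∀ r x, fderiv ℝ (Φ r) x = (fderiv ℝ F (r, x)).comp ι₂ := by
    intro r x
    have h1 : HasFDerivAt (fun x : EuclideanSpace ℝ (Fin 3) => ((r, x) : ℝ × EuclideanSpace ℝ (Fin 3))) ι₂ x :=
      hasFDerivAt_prodMk_right r x
    have h2 := (hFd (r, x)).hasFDerivAt.comp x h1
    exact h2.fderiv
  -- (2) the time derivative of `F` is `W ∘ F`: `DF(q)(1,0) = W (F q)`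
  have htime : ∀ q : ℝ × EuclideanSpace ℝ (Fin 3), fderiv ℝ F q ((1 : ℝ), (0 : EuclideanSpace ℝ (Fin 3))) = W (F q) := by
    rintro ⟨r, x⟩
    have h1 : HasFDerivAt (fun r : ℝ => ((r, x) : ℝ × EuclideanSpace ℝ (Fin 3))) ι₁ r := hasFDerivAt_prodMk_left r x
    have h2 := (hFd (r, x)).hasFDerivAt.comp r h1
    -- as a derivative in `r`
    have h3 : HasDerivAt (fun r : ℝ => F (r, x)) ((fderiv ℝ F (r, x)).comp ι₁ 1) r := h2.hasDerivAt
    have h4 : HasDerivAt (fun r : ℝ => F (r, x)) (W (F (r, x))) r := hasDerivAt_flow (γ := γ) hV1 hK r x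
    have h5 := h3.unique h4
    rw [← h5]
    simp [hι₁]
  -- (3) derivative of `r ↦ DF(r, y)` and of its slice
  have hA : HasDerivAt (fun r : ℝ => fderiv ℝ F (r, y))
      (fderiv ℝ (fderiv ℝ F) (s, y) ((1 : ℝ), (0 : EuclideanSpace ℝ (Fin 3)))) s := by
    have h1 : HasFDerivAt (fun r : ℝ => ((r, y) : ℝ × EuclideanSpace ℝ (Fin 3))) ι₁ s := hasFDerivAt_prodMk_left s y
    have h2 := ((hDFd (s, y)).hasFDerivAt.comp s h1).hasDerivAt
    refine h2.congr_deriv ?_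
    simp [hι₁]
  have hB : HasDerivAt (fun r : ℝ => (fderiv ℝ F (r, y)).comp ι₂)
      ((fderiv ℝ (fderiv ℝ F) (s, y) ((1 : ℝ), (0 : EuclideanSpace ℝ (Fin 3)))).comp ι₂) s := by
    have hL : HasFDerivAt (fun A : ℝ × EuclideanSpace ℝ (Fin 3) →L[ℝ] EuclideanSpace ℝ (Fin 3) => A.comp ι₂)
        ((ContinuousLinearMap.compL ℝ (EuclideanSpace ℝ (Fin 3)) (ℝ × EuclideanSpace ℝ (Fin 3))
          (EuclideanSpace ℝ (Fin 3))).flip ι₂) (fderiv ℝ F (s, y)) :=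
      ((ContinuousLinearMap.compL ℝ (EuclideanSpace ℝ (Fin 3)) (ℝ × EuclideanSpace ℝ (Fin 3))
          (EuclideanSpace ℝ (Fin 3))).flip ι₂).hasFDerivAt
    have h := hL.comp_hasDerivAt s hA
    refine h.congr_deriv ?_
    simp
  -- (4) symmetry of `D²F` and identification
  have hsymm : ∀ w : EuclideanSpace ℝ (Fin 3),
      fderiv ℝ (fderiv ℝ F) (s, y) ((1 : ℝ), (0 : EuclideanSpace ℝ (Fin 3))) ((0 : ℝ), w) =
        fderiv ℝ (fderiv ℝ F) (s, y) ((0 : ℝ), w) ((1 : ℝ), (0 : EuclideanSpace ℝ (Fin 3))) :=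
    fun w => (hF2.contDiffAt.isSymmSndFDerivAt (by simp)) _ _
  have hident : ∀ w : EuclideanSpace ℝ (Fin 3),
      fderiv ℝ (fderiv ℝ F) (s, y) ((0 : ℝ), w) ((1 : ℝ), (0 : EuclideanSpace ℝ (Fin 3))) =
        fderiv ℝ W (F (s, y)) (fderiv ℝ F (s, y) ((0 : ℝ), w)) := by
    intro w
    -- `q ↦ DF(q)(1,0)` is `W ∘ F`
    have h1 : fderiv ℝ (fun q => fderiv ℝ F q ((1 : ℝ), (0 : EuclideanSpace ℝ (Fin 3)))) (s, y) ((0 : ℝ), w) =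
        fderiv ℝ (fderiv ℝ F) (s, y) ((0 : ℝ), w) ((1 : ℝ), (0 : EuclideanSpace ℝ (Fin 3))) := by
      rw [fderiv_clm_apply (hDFd (s, y)) (differentiableAt_const _), fderiv_const_apply,
        ContinuousLinearMap.comp_zero, zero_add, ContinuousLinearMap.flip_apply]
    have h2 : (fun q => fderiv ℝ F q ((1 : ℝ), (0 : EuclideanSpace ℝ (Fin 3)))) = fun q => W (F q) := funext htime
    have hc : fderiv ℝ (fun q => W (F q)) (s, y) = (fderiv ℝ W (F (s, y))).comp (fderiv ℝ F (s, y)) :=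
      ((hWd (F (s, y))).hasFDerivAt.comp (s, y) (hFd (s, y)).hasFDerivAt).fderiv
    rw [← h1, h2, hc]
    rfl
  -- (5) assemble
  have hgoal : (fderiv ℝ (fderiv ℝ F) (s, y) ((1 : ℝ), (0 : EuclideanSpace ℝ (Fin 3)))).comp ι₂ =
      ((γ • ContinuousLinearMap.id ℝ (EuclideanSpace ℝ (Fin 3)) + fderiv ℝ V (Φ s y)).comp (fderiv ℝ (Φ s) y)) := by
    ext1 w
    rw [ContinuousLinearMap.comp_apply, hslice s y, ContinuousLinearMap.comp_apply,
      ← (hasFDerivAt_selfSimilarTransport (γ := γ) (c := 0) hVd (Φ s y)).fderiv]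
    have : ι₂ w = ((0 : ℝ), w) := rfl
    rw [this, hsymm w, hident w]
    rfl
  have hfun : (fun r => fderiv ℝ (Φ r) y) = fun r => (fderiv ℝ F (r, y)).comp ι₂ := funext fun r => hslice r y
  rw [hfun, ← hgoal]
  exact hB

/-! ### Every far trajectory is outgoing (`C¹`, `‖V‖ ≤ M`) -/

/-- **`‖e^{−γs} Φ_s(y) − y‖ ≤ (M/γ)(1 − e^{−γs})` for `s ≥ 0`** (the renormalised trajectory moves at speed
`e^{−γs}‖V‖ ≤ M e^{−γs}`). [cite: ConstantinIgnatovaVicol2026Putative, §3.4.1 eq. (3.21)] -/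
theorem norm_exp_neg_smul_flow_sub_le (hV : ContDiff ℝ 1 V) {K : ℝ} (hK : ∀ y, ‖fderiv ℝ V y‖ ≤ K)
    {M : ℝ} (hM : ∀ y, ‖V y‖ ≤ M) (hγ : 0 < γ) {s : ℝ} (hs : 0 ≤ s)
    (y : EuclideanSpace ℝ (Fin 3)) :
    ‖Real.exp (-γ * s) • ODE.evolutionMap (fun _ : ℝ => selfSimilarTransport γ 0 V) 0 s y - y‖ ≤
      M / γ * (1 - Real.exp (-γ * s)) := by
  set Φ := ODE.evolutionMap (fun _ : ℝ => selfSimilarTransport γ 0 V) 0 with hΦ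
  have hder : ∀ r, HasDerivAt (fun r => Real.exp (-γ * r) • Φ r y - y)
      (Real.exp (-γ * r) • V (Φ r y)) r := by
    intro r
    have h1 : HasDerivAt (fun r => Real.exp (-γ * r)) (Real.exp (-γ * r) * (-γ)) r := by
      simpa using ((hasDerivAt_id r).const_mul (-γ)).exp
    have h2 := hasDerivAt_flow (γ := γ) hV hK r y
    refine ((h1.smul h2).sub_const y).congr_deriv ?_
    simp only [hΦ, selfSimilarTransport_apply, sub_zero, smul_add, smul_smul]
    module
  have hBder : ∀ r, HasDerivAt (fun r => M / γ * (1 - Real.exp (-γ * r)))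
      (M * Real.exp (-γ * r)) r := by
    intro r
    have h1 : HasDerivAt (fun r => Real.exp (-γ * r)) (Real.exp (-γ * r) * (-γ)) r := by
      simpa using ((hasDerivAt_id r).const_mul (-γ)).exp
    refine ((h1.const_sub 1).const_mul (M / γ)).congr_deriv ?_
    field_simp
  have h0 : ‖Real.exp (-γ * 0) • Φ 0 y - y‖ ≤ M / γ * (1 - Real.exp (-γ * 0)) := by
    simp [hΦ, ODE.evolutionMap_self]
  have key := image_norm_le_of_norm_deriv_right_le_deriv_boundary
    (f := fun r => Real.exp (-γ * r) • Φ r y - y) (f' := fun r => Real.exp (-γ * r) • V (Φ r y))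
    (a := 0) (b := s) (B := fun r => M / γ * (1 - Real.exp (-γ * r)))
    (B' := fun r => M * Real.exp (-γ * r))
    (fun r _ => (hder r).continuousAt.continuousWithinAt)
    (fun r _ => (hder r).hasDerivWithinAt) h0 (fun r => hBder r)
    (fun r _ => by
      rw [norm_smul, Real.norm_eq_abs, abs_of_pos (Real.exp_pos _), mul_comm]
      exact mul_le_mul_of_nonneg_right (hM _) (Real.exp_pos _).le)
  exact key (right_mem_Icc.2 hs)

/-- **Outgoing lower bound**: `e^{γs}(‖y‖ − M/γ) ≤ ‖Φ_s(y)‖` for `s ≥ 0`. [cite: ConstantinIgnatovaVicol2026Putative, §3.4.1 eq. (3.21)] -/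
theorem norm_flow_ge (hV : ContDiff ℝ 1 V) {K : ℝ} (hK : ∀ y, ‖fderiv ℝ V y‖ ≤ K)
    {M : ℝ} (hM : ∀ y, ‖V y‖ ≤ M) (hγ : 0 < γ) {s : ℝ} (hs : 0 ≤ s)
    (y : EuclideanSpace ℝ (Fin 3)) :
    Real.exp (γ * s) * (‖y‖ - M / γ) ≤
      ‖ODE.evolutionMap (fun _ : ℝ => selfSimilarTransport γ 0 V) 0 s y‖ := by
  set z := ODE.evolutionMap (fun _ : ℝ => selfSimilarTransport γ 0 V) 0 s y with hz
  have h := norm_exp_neg_smul_flow_sub_le (γ := γ) hV hK hM hγ hs y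
  rw [← hz] at h
  have hM0 : 0 ≤ M := (norm_nonneg _).trans (hM 0)
  have h1 : ‖Real.exp (-γ * s) • z - y‖ ≤ M / γ :=
    h.trans (mul_le_of_le_one_right (div_nonneg hM0 hγ.le) (by linarith [Real.exp_pos (-γ * s)]))
  have h2 : ‖y‖ - M / γ ≤ ‖Real.exp (-γ * s) • z‖ := by
    have := norm_sub_norm_le y (Real.exp (-γ * s) • z)
    rw [← norm_neg, neg_sub] at h1
    linarith
  rw [norm_smul, Real.norm_eq_abs, abs_of_pos (Real.exp_pos _)] at h2
  have h3 : Real.exp (γ * s) * (Real.exp (-γ * s) * ‖z‖) = ‖z‖ := by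
    rw [← mul_assoc, ← Real.exp_add]; simp
  calc Real.exp (γ * s) * (‖y‖ - M / γ) ≤ Real.exp (γ * s) * (Real.exp (-γ * s) * ‖z‖) :=
        mul_le_mul_of_nonneg_left h2 (Real.exp_pos _).le
    _ = ‖z‖ := h3

/-- **Outgoing upper bound**: `‖Φ_s(y)‖ ≤ e^{γs}(‖y‖ + M/γ)` for `s ≥ 0`. [cite: ConstantinIgnatovaVicol2026Putative, §3.4.1 eq. (3.21)] -/
theorem norm_flow_le (hV : ContDiff ℝ 1 V) {K : ℝ} (hK : ∀ y, ‖fderiv ℝ V y‖ ≤ K)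
    {M : ℝ} (hM : ∀ y, ‖V y‖ ≤ M) (hγ : 0 < γ) {s : ℝ} (hs : 0 ≤ s)
    (y : EuclideanSpace ℝ (Fin 3)) :
    ‖ODE.evolutionMap (fun _ : ℝ => selfSimilarTransport γ 0 V) 0 s y‖ ≤
      Real.exp (γ * s) * (‖y‖ + M / γ) := by
  set z := ODE.evolutionMap (fun _ : ℝ => selfSimilarTransport γ 0 V) 0 s y with hz
  have h := norm_exp_neg_smul_flow_sub_le (γ := γ) hV hK hM hγ hs y
  rw [← hz] at h
  have hM0 : 0 ≤ M := (norm_nonneg _).trans (hM 0)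
  have h1 : ‖Real.exp (-γ * s) • z - y‖ ≤ M / γ :=
    h.trans (mul_le_of_le_one_right (div_nonneg hM0 hγ.le) (by linarith [Real.exp_pos (-γ * s)]))
  have h2 : ‖Real.exp (-γ * s) • z‖ ≤ ‖y‖ + M / γ := by
    have := norm_le_norm_add_norm_sub' (Real.exp (-γ * s) • z) y
    linarith
  rw [norm_smul, Real.norm_eq_abs, abs_of_pos (Real.exp_pos _)] at h2
  have h3 : Real.exp (γ * s) * (Real.exp (-γ * s) * ‖z‖) = ‖z‖ := by
    rw [← mul_assoc, ← Real.exp_add]; simp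
  calc ‖z‖ = Real.exp (γ * s) * (Real.exp (-γ * s) * ‖z‖) := h3.symm
    _ ≤ Real.exp (γ * s) * (‖y‖ + M / γ) := mul_le_mul_of_nonneg_left h2 (Real.exp_pos _).le

/-- **Backward confinement of a bounded `C¹` profile**: `‖Φ_s x‖ ≤ ‖x‖ + M/γ` for `s ≤ 0` — no pressure, no profile
equation (the `C¹` form of `Kelvin.norm_flow_le_of_nonpos'`). [folklore] -/
theorem norm_flow_le_of_nonpos' (hV : ContDiff ℝ 1 V) {K : ℝ} (hK : ∀ y, ‖fderiv ℝ V y‖ ≤ K)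
    {M : ℝ} (hM : ∀ y, ‖V y‖ ≤ M) (hγ : 0 < γ) (x : EuclideanSpace ℝ (Fin 3)) {s : ℝ} (hs : s ≤ 0) :
    ‖ODE.evolutionMap (fun _ : ℝ => selfSimilarTransport γ 0 V) 0 s x‖ ≤ ‖x‖ + M / γ := by
  set z := ODE.evolutionMap (fun _ : ℝ => selfSimilarTransport γ 0 V) 0 s x with hz
  have hM0 : 0 ≤ M := (norm_nonneg _).trans (hM 0)
  have hback : ODE.evolutionMap (fun _ : ℝ => selfSimilarTransport γ 0 V) 0 (-s) z = x := by
    rw [hz, ← flow_add hV hK (-s) s x, neg_add_cancel, ODE.evolutionMap_self]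
  have h := norm_flow_ge (γ := γ) hV hK hM hγ (neg_nonneg.2 hs) z
  rw [hback] at h
  have hexp : 1 ≤ Real.exp (γ * (-s)) := Real.one_le_exp (mul_nonneg hγ.le (neg_nonneg.2 hs))
  by_cases hle : ‖z‖ - M / γ ≤ 0
  · linarith [norm_nonneg x, div_nonneg hM0 hγ.le]
  · push Not at hle
    have h2 : ‖z‖ - M / γ ≤ Real.exp (γ * (-s)) * (‖z‖ - M / γ) := le_mul_of_one_le_left hle.le hexp
    linarith

end Summit.NavierStokesRegularity.NavierStokesRegularity.Theorems.PowerGaugeEulerLiouville.C2.Kelvin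

end
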